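import Literature.AnabelianGeometry.EtaleTheta.RealificationOrderWeak
import Literature.AnabelianGeometry.EtaleTheta.RealificationExtension

/-!
# [EtTh] Lemma 3.5, realification portion, for WEAKLY perf-factorial `P` with `P^pf` cofinal in `P^rlf`

Source: S. Mochizuki, *The étale theta function …* [MochizukiEtTh2009], Lemma 3.5 (i), (ii), PDF pp. 75–76
(printed 301–302).  Weak-hypothesis twin of `RealificationExtension.lean` (same seat, same construction —
`φ(x)` is THE element of `Q` squeezed between `ι({a ∈ P^pf | a ≤ x})` and `ι({b ∈ P^pf | x ≤ b})`):
`P` is only WEAKLY perf-factorial ([FrdI] Def. 2.4 (i) (a)(b)(c) + (d_ord) + (d_res), the abc-iut cell's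
repair of finding F-L2d2-1, tree `Frobenioids/PerfFactorialWeak.lean`) and the realification is
`IsPerfFactorialWeak.Rlf`.

THE EXTRA HYPOTHESIS `hcof` ("`P^pf` is cofinal in `P^rlf`": every `x ∈ P^rlf` lies below some
`b ∈ P^pf`) is the printed sentence "it follows from the definition of the realification … that for every
`a ∈ P^rlf`, there exists an `a' ∈ P^pf` such that `a' ≥ a`" (p. 75).  Under the printed Def. 2.4 (i)(d)
it is a theorem (`RlfCoordWeak.rlf_cofinal_of_isPerfFactorial`); under the weak notion it is NOT
(`M = {bounded ℕ → ℤ≥0}`: `M^rlf = ∏_ℕ ℝ≥0`), and without it Lemma 3.5 (i) FAILS (finding F-L2d2-2 of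
the abc-iut cell: an extension `P^rlf → Q` need not exist).  With it, the printed proof goes through
verbatim, the two-sided approximation being supplied by `RealificationOrderWeak.lean` from (d_res).

Results (`Lemma35Weak.*`): `exists_rlf_hom_comp_eq` (existence of `φ : P^rlf → Q` extending any
`ι : P^pf → Q`), `rlf_hom_ext` (uniqueness), `dvd_of_rlf_hom_dvd` (order reflection when `ι` is injective
with group-saturated image).  The `Q`-side lemmas `Lemma35.exists_between` / `Lemma35.between_unique` are
reused from `RealificationExtension.lean`.  Proof-only (no definitions).  Seat abc-iut-L2-d2 (cell
abc-iut, F-L2d2-1 repair chain, node EtTh:Lem3.5).  HONEST FRAMING: classical monoid algebra; nothing here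
bears on [IUTchIII] Cor. 3.12.
-/

namespace Literature.AnabelianGeometry.EtaleTheta

namespace Lemma35Weak

open Literature.AlgebraicGeometry.Frobenioids NNReal Function Lemma35

universe u

variable {Q : Type u} [CommMonoid Q]

/-! ### The extension `φ : P^rlf → Q` through between-elements (weak `P`, cofinal `P^pf`) -/

section Construction

variable {P : Submonoid Q}

/-- Uniqueness of an element of `Q` squeezed between `ι({a·a' | a ≤ x, a' ≤ y})` and
`ι({b·b' | x ≤ b, y ≤ b'})` (`a, a', b, b' ∈ P^pf`; `x, y ∈ P^rlf`): the two families come within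
`n`-th roots of the product of gauges of `x` and `y`. [cite: MochizukiEtTh2009, Lem 3.5 p.76] -/
private theorem between₂_unique (hP : IsPerfFactorialWeak P)
    (hcof : ∀ x : hP.Rlf, ∃ b : Perfection P, x ∣ hP.toRealification b)
    (hb : ∀ 𝔮 : Primes (Perfection P), IsMonoprime (PfAt P 𝔮)) (ι : Perfection P →* Q)
    (hR : Supports Q MonoidType.R) (x y : hP.Rlf) {q q' : Q}
    (hq : (∀ a a' : Perfection P, hP.toRealification a ∣ x → hP.toRealification a' ∣ y → ι (a * a') ∣ q) ∧
      ∀ b b' : Perfection P, x ∣ hP.toRealification b → y ∣ hP.toRealification b' → q ∣ ι (b * b'))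
    (hq' : (∀ a a' : Perfection P, hP.toRealification a ∣ x → hP.toRealification a' ∣ y → ι (a * a') ∣ q') ∧
      ∀ b b' : Perfection P, x ∣ hP.toRealification b → y ∣ hP.toRealification b' → q' ∣ ι (b * b')) :
    q = q' := by
  obtain ⟨bx, -, hgx⟩ := RlfCoordWeak.exists_gauge hP hb hcof x
  obtain ⟨by_, -, hgy⟩ := RlfCoordWeak.exists_gauge hP hb hcof y
  let L : Set Q := {l | ∃ a a' : Perfection P,
    hP.toRealification a ∣ x ∧ hP.toRealification a' ∣ y ∧ ι (a * a') = l}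
  let U : Set Q := {w | ∃ b b' : Perfection P,
    x ∣ hP.toRealification b ∧ y ∣ hP.toRealification b' ∧ ι (b * b') = w}
  have hgap : ∀ n : ℕ+, ∃ l ∈ L, ∃ e : Q, e ^ (n : ℕ) = ι (bx * by_) ∧ l * e ∈ U := by
    intro n
    obtain ⟨a, ha, hax⟩ := hgx n
    obtain ⟨a', ha', hay⟩ := hgy n
    refine ⟨ι (a * a'), ⟨a, a', ha, ha', rfl⟩,
      ι (isPerfect_perfection.root n bx * isPerfect_perfection.root n by_), ?_, ?_⟩
    · rw [← map_pow, mul_pow, IsPerfect.root_pow, IsPerfect.root_pow]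
    · refine ⟨a * isPerfect_perfection.root n bx, a' * isPerfect_perfection.root n by_, hax, hay, ?_⟩
      rw [← map_mul]
      congr 1
      simp only [mul_assoc, mul_left_comm]
  have mk : ∀ {t : Q},
      ((∀ a a' : Perfection P, hP.toRealification a ∣ x → hP.toRealification a' ∣ y → ι (a * a') ∣ t) ∧
        ∀ b b' : Perfection P, x ∣ hP.toRealification b → y ∣ hP.toRealification b' → t ∣ ι (b * b')) →
      (∀ l ∈ L, l ∣ t) ∧ ∀ w ∈ U, t ∣ w := by
    intro t ht
    constructor
    · rintro _ ⟨a, a', ha, ha', rfl⟩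
      exact ht.1 a a' ha ha'
    · rintro _ ⟨b, b', hb1, hb2, rfl⟩
      exact ht.2 b b' hb1 hb2
  exact between_unique hR hgap (mk hq) (mk hq')

/-- Uniqueness of an element of `Q` squeezed between `ι({a | a ≤ x})` and `ι({b | x ≤ b})`.
[cite: MochizukiEtTh2009, Lem 3.5 p.76] -/
private theorem between_point_unique (hP : IsPerfFactorialWeak P)
    (hcof : ∀ x : hP.Rlf, ∃ b : Perfection P, x ∣ hP.toRealification b)
    (hb : ∀ 𝔮 : Primes (Perfection P), IsMonoprime (PfAt P 𝔮)) (ι : Perfection P →* Q)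
    (hR : Supports Q MonoidType.R) (x : hP.Rlf) {q q' : Q}
    (hq : (∀ a : Perfection P, hP.toRealification a ∣ x → ι a ∣ q) ∧
      ∀ b : Perfection P, x ∣ hP.toRealification b → q ∣ ι b)
    (hq' : (∀ a : Perfection P, hP.toRealification a ∣ x → ι a ∣ q') ∧
      ∀ b : Perfection P, x ∣ hP.toRealification b → q' ∣ ι b) :
    q = q' := by
  have lift : ∀ {t : Q}, ((∀ a : Perfection P, hP.toRealification a ∣ x → ι a ∣ t) ∧
      ∀ b : Perfection P, x ∣ hP.toRealification b → t ∣ ι b) →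
      ((∀ a a' : Perfection P, hP.toRealification a ∣ x → hP.toRealification a' ∣ 1 → ι (a * a') ∣ t) ∧
        ∀ b b' : Perfection P, x ∣ hP.toRealification b → (1 : hP.Rlf) ∣ hP.toRealification b' →
          t ∣ ι (b * b')) := by
    intro t ht
    constructor
    · intro a a' ha ha'
      apply ht.1
      rw [map_mul]
      simpa using mul_dvd_mul ha ha'
    · intro b b' hb1 _
      rw [map_mul]
      exact (ht.2 b hb1).trans (dvd_mul_right _ _)
  exact between₂_unique hP hcof hb ι hR x 1 (lift hq) (lift hq')

/-- Existence of an element of `Q` squeezed between `ι({a | a ≤ x})` and `ι({b | x ≤ b})` (the value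
`φ(x)`; "this sum converges", p. 75). [cite: MochizukiEtTh2009, Lem 3.5 p.75] -/
private theorem between_point_exists (hP : IsPerfFactorialWeak P)
    (hcof : ∀ x : hP.Rlf, ∃ b : Perfection P, x ∣ hP.toRealification b)
    (hb : ∀ 𝔮 : Primes (Perfection P), IsMonoprime (PfAt P 𝔮)) (ι : Perfection P →* Q)
    (hR : Supports Q MonoidType.R) (x : hP.Rlf) :
    ∃ q : Q, (∀ a : Perfection P, hP.toRealification a ∣ x → ι a ∣ q) ∧
      ∀ b : Perfection P, x ∣ hP.toRealification b → q ∣ ι b := by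
  let L : Set Q := {l | ∃ a : Perfection P, hP.toRealification a ∣ x ∧ ι a = l}
  let U : Set Q := {w | ∃ b : Perfection P, x ∣ hP.toRealification b ∧ ι b = w}
  have hLU : ∀ l ∈ L, ∀ w ∈ U, l ∣ w := by
    rintro _ ⟨a, ha, rfl⟩ _ ⟨b, hb', rfl⟩
    exact map_dvd ι ((RlfCoordWeak.toRealification_dvd_iff hP hb a b).mp (ha.trans hb'))
  have hL : L.Nonempty := ⟨ι 1, 1, by rw [map_one]; exact one_dvd x, rfl⟩
  obtain ⟨b₀, hb₀, -⟩ := RlfCoordWeak.exists_gauge hP hb hcof x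
  have hU : U.Nonempty := ⟨ι b₀, b₀, hb₀, rfl⟩
  obtain ⟨s, hs, hs'⟩ := exists_between hR hLU hL hU
  exact ⟨s, fun a ha => hs _ ⟨a, ha, rfl⟩, fun b hb' => hs' _ ⟨b, hb', rfl⟩⟩

/-- **Construction of `φ : P^rlf → Q`.** There is a monoid homomorphism `φ` such that each `φ(x)` is
squeezed between `ι({a ∈ P^pf | a ≤ x})` and `ι({b ∈ P^pf | x ≤ b})` (additivity by uniqueness of the
squeezed element for products). [cite: MochizukiEtTh2009, Lem 3.5 p.75] -/
private theorem exists_hom_between (hP : IsPerfFactorialWeak P)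
    (hcof : ∀ x : hP.Rlf, ∃ b : Perfection P, x ∣ hP.toRealification b)
    (hb : ∀ 𝔮 : Primes (Perfection P), IsMonoprime (PfAt P 𝔮)) (ι : Perfection P →* Q)
    (hR : Supports Q MonoidType.R) :
    ∃ φ : hP.Rlf →* Q, ∀ x : hP.Rlf, (∀ a : Perfection P, hP.toRealification a ∣ x → ι a ∣ φ x) ∧
      ∀ b : Perfection P, x ∣ hP.toRealification b → φ x ∣ ι b := by
  choose Φ hΦ using between_point_exists hP hcof hb ι hR
  refine ⟨{ toFun := Φ, map_one' := ?_, map_mul' := fun x y => ?_ }, hΦ⟩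
  · apply between_point_unique hP hcof hb ι hR 1 (hΦ 1)
    constructor
    · intro a ha
      rw [← map_one hP.toRealification, RlfCoordWeak.toRealification_dvd_iff hP hb] at ha
      rw [← map_one ι]
      exact map_dvd ι ha
    · intro b _
      exact one_dvd _
  · apply between₂_unique hP hcof hb ι hR x y
    · constructor
      · intro a a' ha ha'
        apply (hΦ (x * y)).1
        rw [map_mul]
        exact mul_dvd_mul ha ha'
      · intro b b' hb1 hb2
        apply (hΦ (x * y)).2
        rw [map_mul]
        exact mul_dvd_mul hb1 hb2
    · constructor
      · intro a a' ha ha'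
        rw [map_mul]
        exact mul_dvd_mul ((hΦ x).1 a ha) ((hΦ y).1 a' ha')
      · intro b b' hb1 hb2
        rw [map_mul]
        exact mul_dvd_mul ((hΦ x).2 b hb1) ((hΦ y).2 b' hb2)

/-- A homomorphism `ψ : P^rlf → Q` extending `ι : P^pf → Q` is squeezed: `ι a ≤ ψ x ≤ ι b` whenever
`a ≤ x ≤ b`. [cite: MochizukiEtTh2009, Lem 3.5 p.76] -/
private theorem between_of_comp_eq (hP : IsPerfFactorialWeak P) (ι : Perfection P →* Q) (ψ : hP.Rlf →* Q)
    (hψ : ψ.comp hP.toRealification = ι) (x : hP.Rlf) :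
    (∀ a : Perfection P, hP.toRealification a ∣ x → ι a ∣ ψ x) ∧
      ∀ b : Perfection P, x ∣ hP.toRealification b → ψ x ∣ ι b := by
  constructor
  · intro a ha
    rw [← hψ]
    exact map_dvd ψ ha
  · intro b hb'
    rw [← hψ]
    exact map_dvd ψ hb'

/-- **Existence of the extension** `P^pf → Q` ↝ `P^rlf → Q` (weak `P`, cofinal `P^pf ⊆ P^rlf`): for
every `ι : P^pf → Q` there is `φ : P^rlf → Q` with `φ ∘ (P^pf → P^rlf) = ι`, provided `ℝ` supports `Q`
("extends … to a homomorphism of monoids `φ : P^rlf → Q`", pp. 75–76). [cite: MochizukiEtTh2009, Lem 3.5 p.75] -/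
theorem exists_rlf_hom_comp_eq (hP : IsPerfFactorialWeak P)
    (hcof : ∀ x : hP.Rlf, ∃ b : Perfection P, x ∣ hP.toRealification b)
    (hb : ∀ 𝔮 : Primes (Perfection P), IsMonoprime (PfAt P 𝔮)) (ι : Perfection P →* Q)
    (hR : Supports Q MonoidType.R) :
    ∃ φ : hP.Rlf →* Q, φ.comp hP.toRealification = ι := by
  obtain ⟨φ, hφ⟩ := exists_hom_between hP hcof hb ι hR
  refine ⟨φ, MonoidHom.ext fun a₀ => ?_⟩
  apply between_point_unique hP hcof hb ι hR (hP.toRealification a₀) (hφ _)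
  constructor
  · intro a ha
    exact map_dvd ι ((RlfCoordWeak.toRealification_dvd_iff hP hb a a₀).mp ha)
  · intro b hb'
    exact map_dvd ι ((RlfCoordWeak.toRealification_dvd_iff hP hb a₀ b).mp hb')

/-- **Uniqueness of the extension** (weak `P`, cofinal `P^pf ⊆ P^rlf`): two homomorphisms `P^rlf → Q`
that agree on `P^pf` coincide, provided `ℝ` supports `Q` ("uniquely characterized by the property that it
extends the natural homomorphism of monoids `P^pf → Q`", p. 76). [cite: MochizukiEtTh2009, Lem 3.5 p.76] -/
theorem rlf_hom_ext (hP : IsPerfFactorialWeak P)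
    (hcof : ∀ x : hP.Rlf, ∃ b : Perfection P, x ∣ hP.toRealification b)
    (hb : ∀ 𝔮 : Primes (Perfection P), IsMonoprime (PfAt P 𝔮)) (ι : Perfection P →* Q)
    (hR : Supports Q MonoidType.R) (ψ ψ' : hP.Rlf →* Q)
    (hψ : ψ.comp hP.toRealification = ι) (hψ' : ψ'.comp hP.toRealification = ι) : ψ = ψ' :=
  MonoidHom.ext fun x => between_point_unique hP hcof hb ι hR x
    (between_of_comp_eq hP ι ψ hψ x) (between_of_comp_eq hP ι ψ' hψ' x)

/-- **Order reflection** (weak `P`, cofinal `P^pf ⊆ P^rlf`; "we conclude that `a ≥ b`", p. 76): if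
`ι : P^pf ↪ Q` is injective with group-saturated image — the `P^pf` portion of Lemma 3.5 (i), (ii) — then
any `ψ : P^rlf → Q` extending `ι` reflects `≤`: `ψ x ≤ ψ y ⇒ x ≤ y`. [cite: MochizukiEtTh2009, Lem 3.5 p.76] -/
theorem dvd_of_rlf_hom_dvd (hP : IsPerfFactorialWeak P)
    (hcof : ∀ x : hP.Rlf, ∃ b : Perfection P, x ∣ hP.toRealification b)
    (hb : ∀ 𝔮 : Primes (Perfection P), IsMonoprime (PfAt P 𝔮)) (ι : Perfection P →* Q)
    (hιinj : Injective ι)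
    (hιsat : IsGroupSaturated (MonoidHom.mrange ι)) (ψ : hP.Rlf →* Q)
    (hψ : ψ.comp hP.toRealification = ι) {x y : hP.Rlf} (h : ψ x ∣ ψ y) : x ∣ y := by
  -- `ι` reflects divisibility, by group-saturation of its image and injectivity
  have hιdvd : ∀ a b : Perfection P, ι a ∣ ι b → a ∣ b := by
    rintro a b ⟨q, hq⟩
    rw [isGroupSaturated_iff'] at hιsat
    have hqmem : q ∈ MonoidHom.mrange ι :=
      hιsat q (ι b) ⟨b, rfl⟩ (ι a) ⟨a, rfl⟩ (by rw [mul_comm]; exact hq.symm)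
    obtain ⟨d, rfl⟩ := MonoidHom.mem_mrange.mp hqmem
    exact ⟨d, hιinj (by rw [map_mul, hq])⟩
  obtain ⟨bx, -, hgx⟩ := RlfCoordWeak.exists_gauge hP hb hcof x
  obtain ⟨by_, -, hgy⟩ := RlfCoordWeak.exists_gauge hP hb hcof y
  apply RlfCoordWeak.dvd_of_forall_root hP hb (C := hP.toRealification (bx * by_))
  intro n
  obtain ⟨a, ha, hax⟩ := hgx n
  obtain ⟨a', ha', hay⟩ := hgy n
  set ex := isPerfect_perfection.root n bx with hex
  set ey := isPerfect_perfection.root n by_ with hey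
  refine ⟨hP.toRealification (ex * ey), ?_, ?_⟩
  · rw [← map_pow, mul_pow, hex, hey, IsPerfect.root_pow, IsPerfect.root_pow]
  · -- `a ≤ a' · ey` in `P^pf`, via `ι` and `ψ`
    have h1 : ι a ∣ ι (a' * ey) := by
      rw [← hψ]
      exact (map_dvd ψ ha).trans (h.trans (map_dvd ψ hay))
    have h2 : hP.toRealification a ∣ y * hP.toRealification ey := by
      have := map_dvd hP.toRealification (hιdvd _ _ h1)
      rw [map_mul] at this
      exact this.trans (mul_dvd_mul_right ha' _)
    calc x ∣ hP.toRealification (a * ex) := hax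
      _ = hP.toRealification a * hP.toRealification ex := map_mul _ _ _
      _ ∣ (y * hP.toRealification ey) * hP.toRealification ex := mul_dvd_mul_right h2 _
      _ = y * hP.toRealification (ex * ey) := by rw [map_mul, mul_assoc, mul_comm (hP.toRealification ey)]

end Construction

end Lemma35Weak

end Literature.AnabelianGeometry.EtaleTheta
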